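import Summits.SmoothPoincare4.SmoothPoincare4.Theorems.SymplecticOrigamiOrigamiFoldExistenceStableSeamHostReduction
import Literature.Topology.FourManifolds.HomotopySpheres

/-!
# SplitGlue — the split's assembly is ALREADY LANDED (p141078)

`OrigamiFoldExistence_of_subs : HostEmbedding → StableSeam → StableSeamRigidity → OrigamiFoldExistence`
is, up to unfolding the three route defs (and the `⟪·,·⟫_ℝ` vs `⟪·,·⟫` spelling — same term
`inner ℝ`), literally `StableSeamHost.helper_origamiFoldExistence_of_stableSeamHost`
(Theorems/SymplecticOrigamiOrigamiFoldExistenceStableSeamHostReduction.lean, p141078, lead c8).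
This self-contained file re-declares the three pieces exactly as in Sketch.lean and certifies the
`--glue-by` claim: the landed term elaborates at the split's type by definitional unfolding only.
-/

-- the prescribed namespace duplicates `SmoothPoincare4` (P = Sub)
set_option linter.dupNamespace false

namespace Summit.SmoothPoincare4.SmoothPoincare4.Theses.SymplecticOrigami

open scoped BigOperators Topology Manifold Classical MeasureTheory ProbabilityTheory Matrix InnerProductSpace ComplexConjugate ContinuousMap ContDiff
open Filter Set Function TopologicalSpace MeasureTheory

open Literature.SPC4

/-- piece X₁ (crux): RATIONAL HOST (= registered `stub_hostEmbedding` verbatim). -/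
def HostEmbedding : Prop :=
  ∀ (S : Literature.Topology.FourManifolds.HomotopySphere 4) (e : EuclideanSpace ℝ (Fin 4) → S.carrier), Manifold.IsSmoothEmbedding (𝓡 4) (𝓡 4) ∞ e → ∃ (X : Type) (_ : TopologicalSpace X) (_ : T2Space X) (_ : SecondCountableTopology X) (_ : CompactSpace X) (_ : ChartedSpace (EuclideanSpace ℝ (Fin 4)) X) (_ : IsManifold (𝓡 4) ∞ X) (_ : SimplyConnectedSpace X) (Ω : Literature.Geometry.Kaehler.MForm (𝓡 4) X ℝ 2) (J : S.carrier → X) (c c' : (Metric.sphere (0 : EuclideanSpace ℝ (Fin 3)) 1) → X), (Literature.Geometry.Kaehler.IsSmoothForm Ω ∧ Literature.Geometry.Kaehler.IsClosedForm Ω ∧ ∀ x (v : TangentSpace (𝓡 4) x), v ≠ 0 → ∃ w, Ω x ![v, w] ≠ 0) ∧ (∃ U : Set S.carrier, IsOpen U ∧ (e '' Metric.ball (0 : EuclideanSpace ℝ (Fin 4)) 1)ᶜ ⊆ U ∧ ContMDiffOn (𝓡 4) (𝓡 4) ∞ J U ∧ Set.InjOn J U ∧ ∀ x ∈ U, Function.Bijective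 (mfderiv (𝓡 4) (𝓡 4) J x)) ∧ (Manifold.IsSmoothEmbedding (𝓡 2) (𝓡 4) ∞ c ∧ (∀ y (v : TangentSpace (𝓡 2) y), v ≠ 0 → ∃ w : TangentSpace (𝓡 2) y, Ω (c y) ![mfderiv (𝓡 2) (𝓡 4) c y v, mfderiv (𝓡 2) (𝓡 4) c y w] ≠ 0) ∧ Manifold.IsSmoothEmbedding (𝓡 2) (𝓡 4) ∞ c' ∧ Disjoint (Set.range c) (Set.range c') ∧ ∃ H : unitInterval × (Metric.sphere (0 : EuclideanSpace ℝ (Fin 3)) 1) → X, Continuous H ∧ ∀ y, H (0, y) = c y ∧ H (1, y) = c' y)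

/-- piece X₂ (crux): STABLE SEAM (= registered `stub_stableSeam` verbatim, `⟪·,·⟫_ℝ` spelling). -/
def StableSeam : Prop :=
  ∀ (S : Literature.Topology.FourManifolds.HomotopySphere 4) (e : EuclideanSpace ℝ (Fin 4) → S.carrier) (X : Type) [TopologicalSpace X] [T2Space X] [SecondCountableTopology X] [CompactSpace X] [ChartedSpace (EuclideanSpace ℝ (Fin 4)) X] [IsManifold (𝓡 4) ∞ X] [SimplyConnectedSpace X] (Ω : Literature.Geometry.Kaehler.MForm (𝓡 4) X ℝ 2) (J : S.carrier → X) (c c' : (Metric.sphere (0 : EuclideanSpace ℝ (Fin 3)) 1) → X), Manifold.IsSmoothEmbedding (𝓡 4) (𝓡 4) ∞ e → (Literature.Geometry.Kaehler.IsSmoothForm Ω ∧ Literature.Geometry.Kaehler.IsClosedForm Ω ∧ ∀ x (v : TangentSpace (𝓡 4) x), v ≠ 0 → ∃ w, Ω x ![v, w] ≠ 0) → (∃ U : Set S.carrier, IsOpen U ∧ (e '' Metric.ball (0 : EuclideanSpace ℝ (Fin 4)) 1)ᶜ ⊆ U ∧ ContMDiffOn (𝓡 4) (𝓡 4) ∞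 J U ∧ Set.InjOn J U ∧ ∀ x ∈ U, Function.Bijective (mfderiv (𝓡 4) (𝓡 4) J x)) → (Manifold.IsSmoothEmbedding (𝓡 2) (𝓡 4) ∞ c ∧ (∀ y (v : TangentSpace (𝓡 2) y), v ≠ 0 → ∃ w : TangentSpace (𝓡 2) y, Ω (c y) ![mfderiv (𝓡 2) (𝓡 4) c y v, mfderiv (𝓡 2) (𝓡 4) c y w] ≠ 0) ∧ Manifold.IsSmoothEmbedding (𝓡 2) (𝓡 4) ∞ c' ∧ Disjoint (Set.range c) (Set.range c') ∧ ∃ H : unitInterval × (Metric.sphere (0 : EuclideanSpace ℝ (Fin 3)) 1) → X, Continuous H ∧ ∀ y, H (0, y) = c y ∧ H (1, y) = c' y) → ∃ (J' : S.carrier → X) (θ : EuclideanSpace ℝ (Fin 4) → EuclideanSpace ℝ (Fin 4) →L[ℝ] ℝ), (∃ U : Set S.carrier, IsOpen U ∧ (e '' Metric.ball (0 : EuclideanSpace ℝ (Fin 4)) 1)ᶜ ⊆ U ∧ ContMDiffOn (𝓡 4) (𝓡 4) ∞ J' U ∧ Set.InjOn J' U ∧ ∀ x ∈ U, Function.Bijective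 (mfderiv (𝓡 4) (𝓡 4) J' x)) ∧ (ContDiff ℝ ∞ θ ∧ (∀ u : EuclideanSpace ℝ (Fin 4), ‖u‖ = 1 → ∀ v : Fin 3 → EuclideanSpace ℝ (Fin 4), (∀ i, ⟪v i, u⟫_ℝ = 0) → LinearIndependent ℝ v → θ u (v 0) * Ω ((J' ∘ e) u) ![mfderiv (𝓡 4) (𝓡 4) (J' ∘ e) u (v 1), mfderiv (𝓡 4) (𝓡 4) (J' ∘ e) u (v 2)] - θ u (v 1) * Ω ((J' ∘ e) u) ![mfderiv (𝓡 4) (𝓡 4) (J' ∘ e) u (v 0), mfderiv (𝓡 4) (𝓡 4) (J' ∘ e) u (v 2)] + θ u (v 2) * Ω ((J' ∘ e) u) ![mfderiv (𝓡 4) (𝓡 4) (J' ∘ e) u (v 0), mfderiv (𝓡 4) (𝓡 4) (J' ∘ e) u (v 1)] ≠ 0) ∧ (∀ u : EuclideanSpace ℝ (Fin 4), ‖u‖ = 1 → ∀ v : EuclideanSpace ℝ (Fin 4), ⟪v, u⟫_ℝ = 0 → (∀ w : EuclideanSpace ℝ (Fin 4), ⟪w, u⟫_ℝ = 0 → Ω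 ((J' ∘ e) u) ![mfderiv (𝓡 4) (𝓡 4) (J' ∘ e) u v, mfderiv (𝓡 4) (𝓡 4) (J' ∘ e) u w] = 0) → ∀ w : EuclideanSpace ℝ (Fin 4), ⟪w, u⟫_ℝ = 0 → fderiv ℝ θ u v w - fderiv ℝ θ u w v = 0))

/-- piece X₃ (crux): STABLE-SEAM RIGIDITY (= registered `stub_stableSeamRigidity` verbatim, `⟪·,·⟫_ℝ` spelling). -/
def StableSeamRigidity : Prop :=
  ∀ (S : Literature.Topology.FourManifolds.HomotopySphere 4) (e : EuclideanSpace ℝ (Fin 4) → S.carrier) (X : Type) [TopologicalSpace X] [T2Space X] [SecondCountableTopology X] [CompactSpace X] [ChartedSpace (EuclideanSpace ℝ (Fin 4)) X] [IsManifold (𝓡 4) ∞ X] [SimplyConnectedSpace X] (Ω : Literature.Geometry.Kaehler.MForm (𝓡 4) X ℝ 2) (J : S.carrier → X) (c c' : (Metric.sphere (0 : EuclideanSpace ℝ (Fin 3)) 1) → X) (θ : EuclideanSpace ℝ (Fin 4) → EuclideanSpace ℝ (Fin 4) →L[ℝ] ℝ), Manifold.IsSmoothEmbedding (𝓡 4)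 (𝓡 4) ∞ e → (Literature.Geometry.Kaehler.IsSmoothForm Ω ∧ Literature.Geometry.Kaehler.IsClosedForm Ω ∧ ∀ x (v : TangentSpace (𝓡 4) x), v ≠ 0 → ∃ w, Ω x ![v, w] ≠ 0) → (∃ U : Set S.carrier, IsOpen U ∧ (e '' Metric.ball (0 : EuclideanSpace ℝ (Fin 4)) 1)ᶜ ⊆ U ∧ ContMDiffOn (𝓡 4) (𝓡 4) ∞ J U ∧ Set.InjOn J U ∧ ∀ x ∈ U, Function.Bijective (mfderiv (𝓡 4) (𝓡 4) J x)) → (Manifold.IsSmoothEmbedding (𝓡 2) (𝓡 4) ∞ c ∧ (∀ y (v : TangentSpace (𝓡 2) y), v ≠ 0 → ∃ w : TangentSpace (𝓡 2) y, Ω (c y) ![mfderiv (𝓡 2) (𝓡 4) c y v, mfderiv (𝓡 2) (𝓡 4) c y w] ≠ 0) ∧ Manifold.IsSmoothEmbedding (𝓡 2) (𝓡 4) ∞ c' ∧ Disjoint (Set.range c) (Set.range c') ∧ ∃ H : unitInterval × (Metric.sphere (0 : EuclideanSpace ℝ (Fin 3)) 1) → X, Continuous H ∧ ∀ y, H (0,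 y) = c y ∧ H (1, y) = c' y) → (ContDiff ℝ ∞ θ ∧ (∀ u : EuclideanSpace ℝ (Fin 4), ‖u‖ = 1 → ∀ v : Fin 3 → EuclideanSpace ℝ (Fin 4), (∀ i, ⟪v i, u⟫_ℝ = 0) → LinearIndependent ℝ v → θ u (v 0) * Ω ((J ∘ e) u) ![mfderiv (𝓡 4) (𝓡 4) (J ∘ e) u (v 1), mfderiv (𝓡 4) (𝓡 4) (J ∘ e) u (v 2)] - θ u (v 1) * Ω ((J ∘ e) u) ![mfderiv (𝓡 4) (𝓡 4) (J ∘ e) u (v 0), mfderiv (𝓡 4) (𝓡 4) (J ∘ e) u (v 2)] + θ u (v 2) * Ω ((J ∘ e) u) ![mfderiv (𝓡 4) (𝓡 4) (J ∘ e) u (v 0), mfderiv (𝓡 4) (𝓡 4) (J ∘ e) u (v 1)] ≠ 0) ∧ (∀ u : EuclideanSpace ℝ (Fin 4), ‖u‖ = 1 → ∀ v : EuclideanSpace ℝ (Fin 4), ⟪v, u⟫_ℝ = 0 → (∀ w : EuclideanSpace ℝ (Fin 4), ⟪w, u⟫_ℝ = 0 → Ω ((J ∘ e) u) ![mfderiv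 (𝓡 4) (𝓡 4) (J ∘ e) u v, mfderiv (𝓡 4) (𝓡 4) (J ∘ e) u w] = 0) → ∀ w : EuclideanSpace ℝ (Fin 4), ⟪w, u⟫_ℝ = 0 → fderiv ℝ θ u v w - fderiv ℝ θ u w v = 0)) → Nonempty (S.carrier ≃ₘ⟮𝓡 4, 𝓡 4⟯ Metric.sphere (0 : EuclideanSpace ℝ (Fin 5)) 1)


/-- The ASSEMBLY of the split, by the landed reduction (term mode; definitional unfolding only). -/
theorem OrigamiFoldExistence_of_subs :
    HostEmbedding → StableSeam → StableSeamRigidity → OrigamiFoldExistence :=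
  Summit.SmoothPoincare4.SmoothPoincare4.Theorems.OrigamiFoldExistence.StableSeamHost.helper_origamiFoldExistence_of_stableSeamHost

/-- The pieces give the SUMMIT statement too (landed `helper_smoothPoincare4_of_stableSeamHost`). -/
theorem smoothPoincare4_of_subs :
    HostEmbedding → StableSeam → StableSeamRigidity → _root_.SmoothPoincare4 :=
  Summit.SmoothPoincare4.SmoothPoincare4.Theorems.OrigamiFoldExistence.StableSeamHost.helper_smoothPoincare4_of_stableSeamHost

/-- Shield of X₃ (landed): `SmoothPoincare4 → StableSeamRigidity` — X₃ is a CONSEQUENCE of S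
(BC2 converse probe; X₃ is used toward S through the assembly above, so it is a legitimate crux). -/
theorem stableSeamRigidity_of_smoothPoincare4 : _root_.SmoothPoincare4 → StableSeamRigidity :=
  Summit.SmoothPoincare4.SmoothPoincare4.Theorems.OrigamiFoldExistence.StableSeamHost.helper_stableSeamRigidity_of_smoothPoincare4

end Summit.SmoothPoincare4.SmoothPoincare4.Theses.SymplecticOrigami
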